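import Mathlib
import Summits.Schanuel.Schanuel.Theses.RigidCore
import Summits.Schanuel.Schanuel.Theses.GaussianStokesSector
import Summits.Schanuel.Schanuel.Theorems.RigidCoreSchanuelOnLogFreeCoreSectorGlue
import Summits.Schanuel.Schanuel.Theorems.RigidCoreSchanuelOnLogFreeCoreCalibrationR
import Literature.NumberTheory.Transcendental.PeriodsWave0Proofs

/-!
# Line `sector-split` (route `RigidCore`): calibration of residue 2 (`CoreRel`)

Prover file for the registered stub `stub_coreRel_calibration` of line `sector-split` of crux
`stmt-Schanuel-0970` (`Summit.Schanuel.Schanuel.Theses.RigidCore.SchanuelOnLogFreeCore`, (R)).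

Residue 2 of the line, "CoreRel" (item stmt-Schanuel-9548 `RelSchanuelOverPiLWField` restricted to
core tuples): for tuples `x` of the log-free core `C_EA` that are `ℚ`-free modulo
`E = span_ℚ(ℚ̄ ∪ {πi})`, `n ≤ trdeg_{K₂} K₂(x, eˣ)` over the π–LW field
`K₂ = ℚ(ℚ̄ ∪ {πi} ∪ e^{ℚ̄})`.  This file certifies that residue 2 is OPEN-PROBLEM STRENGTH AT ITS
FIRST INSTANCES, independently of residue 1 (`PiFreeOverLWField` ⊇ `e ⊥ π`):

* `CoreRel ⟹ e^{π²}` is transcendental (instance `x = (π²)`: `π² ∈ C_EA`, `π² ∉ E`, `π²` is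
  algebraic over `K₂ ∋ πi`, so `1 ≤ trdeg_{K₂} K₂(π², e^{π²})` forces `e^{π²}` transcendental over
  `K₂ ⊇ ℚ̄`) — the transcendence of `e^{π²}` is a printed open problem (Waldschmidt 2000 §1.4);
* `CoreRel ⟹ e^e` is transcendental (instance `x = (e)`: `e = e¹ ∈ K₂ ∩ C_EA`, `e ∉ E`) — open.

Tool (`CoreRelCalibration.isAlgebraic_of_mem_span_of_conj_eq`): an element `b + qπi` of `E`
fixed by complex conjugation equals `(b + b̄)/2`, hence is algebraic; so the real transcendental
numbers `π²`, `e` are not in `E`.  Everything used is proved in the tree (Lindemann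
`transcendental_pi_holds`, Hermite `transcendental_rat_cexp_one`); `CoreRel` is the hypothesis.
No new definitions.
-/

noncomputable section

namespace Summit.Schanuel.Schanuel.Theorems.RigidCore

open Complex IntermediateField
open Summit.Schanuel.Schanuel.Theses
open Literature.NumberTheory.Transcendental
open Summit.Schanuel.Schanuel.Theorems.AclSubsetLogFreeCore.Negative
  (logFreeCore logFreeCore_mem_coreFamily conjQ conjQ_apply)

namespace CoreRelCalibration

/-- An element of `E = span_ℚ(ℚ̄ ∪ {πi})` fixed by complex conjugation is algebraic:
`b + qπi = conj(b + qπi) = b̄ − qπi` gives `b + qπi = (b + b̄)/2`. [folklore] -/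
theorem isAlgebraic_of_mem_span_of_conj_eq {u : ℂ}
    (hu : u ∈ Submodule.span ℚ ({z : ℂ | IsAlgebraic ℚ z} ∪ {(Real.pi : ℂ) * I}))
    (hconj : (starRingEnd ℂ) u = u) : IsAlgebraic ℚ u := by
  obtain ⟨b, hb, q, rfl⟩ := SectorGlue.exists_eq_add_rat_mul_pi_I_of_mem_span _ hu
  have hb' : IsAlgebraic ℚ b := mem_algebraicClosure_iff.1 hb
  have hcb : IsAlgebraic ℚ ((starRingEnd ℂ) b) := by
    have h := hb'.algHom conjQ
    rwa [conjQ_apply] at h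
  have hc : (starRingEnd ℂ) (b + q * (Real.pi * I)) = (starRingEnd ℂ) b - q * (Real.pi * I) := by
    simp only [map_add, map_mul, map_ratCast, Complex.conj_ofReal, Complex.conj_I]
    ring
  rw [hc] at hconj
  have h2 : b + q * (Real.pi * I) = (b + (starRingEnd ℂ) b) * (((1 / 2 : ℚ) : ℚ) : ℂ) := by
    push_cast
    linear_combination (-1 / 2 : ℂ) * hconj
  rw [h2]
  exact (hb'.add hcb).mul (isAlgebraic_algebraMap ((1 / 2 : ℚ) : ℚ))

/-- A real number lying in `E = span_ℚ(ℚ̄ ∪ {πi})` is algebraic. [folklore] -/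
theorem isAlgebraic_of_real_mem_span {r : ℝ}
    (hr : (r : ℂ) ∈ Submodule.span ℚ ({z : ℂ | IsAlgebraic ℚ z} ∪ {(Real.pi : ℂ) * I})) :
    IsAlgebraic ℚ (r : ℂ) :=
  isAlgebraic_of_mem_span_of_conj_eq hr (Complex.conj_ofReal r)

/-- `π² ∉ E` (else `π²`, hence `π`, would be algebraic — Lindemann). [folklore] -/
theorem pi_sq_not_mem_span :
    ((Real.pi : ℂ) ^ 2) ∉ Submodule.span ℚ ({z : ℂ | IsAlgebraic ℚ z} ∪ {(Real.pi : ℂ) * I}) := by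
  intro h
  have h' : IsAlgebraic ℚ (((Real.pi ^ 2 : ℝ) : ℝ) : ℂ) := by
    refine isAlgebraic_of_real_mem_span ?_
    simpa using h
  have h'' : IsAlgebraic ℚ (Real.pi : ℂ) := by
    refine IsAlgebraic.of_pow two_pos ?_
    simpa using h'
  exact CalibrationR.transcendental_pi_complex h''

/-- `e ∉ E` (else `e` would be algebraic — Hermite). [folklore] -/
theorem exp_one_not_mem_span :
    cexp 1 ∉ Submodule.span ℚ ({z : ℂ | IsAlgebraic ℚ z} ∪ {(Real.pi : ℂ) * I}) := by
  intro h
  have h' : IsAlgebraic ℚ (((Real.exp 1 : ℝ) : ℝ) : ℂ) := by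
    refine isAlgebraic_of_real_mem_span ?_
    simpa [Complex.ofReal_exp] using h
  refine transcendental_rat_cexp_one ?_
  simpa [Complex.ofReal_exp] using h'

/-- **The one-variable instances of `CoreRel`**: for `u ∈ C_EA` with `u ∉ E` and `u` algebraic
over `K₂`, `CoreRel` at `x = (u)` makes `e^u` transcendental over `K₂` (`1 ≤ trdeg_{K₂} K₂(u, e^u)`
and `u` algebraic force `e^u` transcendental). [folklore] -/
theorem transcendental_exp_of_coreRel
    (hC : ∀ (n : ℕ) (x : Fin n → ℂ),
      (∀ i, x i ∈ (sInf {K : IntermediateField ℚ ℂ | (2 * ↑Real.pi * Complex.I : ℂ) ∈ K ∧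
        (∀ w ∈ K, Complex.exp w ∈ K) ∧ ∀ w : ℂ, IsAlgebraic K w → w ∈ K} : IntermediateField ℚ ℂ)) →
      LinearIndependent ℚ ((Submodule.span ℚ ({z : ℂ | IsAlgebraic ℚ z} ∪ {(Real.pi : ℂ) * Complex.I})).mkQ ∘ x) →
      (n : Cardinal) ≤ Algebra.trdeg
        ↥(IntermediateField.adjoin ℚ ({z : ℂ | IsAlgebraic ℚ z} ∪ {(Real.pi : ℂ) * Complex.I} ∪ Complex.exp '' {z : ℂ | IsAlgebraic ℚ z}))
        ↥(IntermediateField.adjoin ↥(IntermediateField.adjoin ℚ ({z : ℂ | IsAlgebraic ℚ z} ∪ {(Real.pi : ℂ) * Complex.I} ∪ Complex.exp '' {z : ℂ | IsAlgebraic ℚ z})) (Set.range x ∪ Set.range (Complex.exp ∘ x))))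
    {u : ℂ} (hu : u ∈ logFreeCore)
    (huE : u ∉ Submodule.span ℚ ({z : ℂ | IsAlgebraic ℚ z} ∪ {(Real.pi : ℂ) * I}))
    (huK : IsAlgebraic ↥(IntermediateField.adjoin ℚ ({z : ℂ | IsAlgebraic ℚ z} ∪
      {(Real.pi : ℂ) * Complex.I} ∪ Complex.exp '' {z : ℂ | IsAlgebraic ℚ z})) u) :
    Transcendental ↥(IntermediateField.adjoin ℚ ({z : ℂ | IsAlgebraic ℚ z} ∪
      {(Real.pi : ℂ) * Complex.I} ∪ Complex.exp '' {z : ℂ | IsAlgebraic ℚ z})) (cexp u) := by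
  intro halg
  set K₂ : IntermediateField ℚ ℂ := IntermediateField.adjoin ℚ ({z : ℂ | IsAlgebraic ℚ z} ∪
    {(Real.pi : ℂ) * Complex.I} ∪ Complex.exp '' {z : ℂ | IsAlgebraic ℚ z}) with hK₂
  have hli : LinearIndependent ℚ
      ((Submodule.span ℚ ({z : ℂ | IsAlgebraic ℚ z} ∪ {(Real.pi : ℂ) * Complex.I})).mkQ ∘ ![u]) := by
    rw [linearIndependent_unique_iff]
    simp only [Function.comp_apply, Fin.default_eq_zero, Matrix.cons_val_zero, Submodule.mkQ_apply,
      ne_eq, Submodule.Quotient.mk_eq_zero]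
    exact huE
  have h1 := hC 1 ![u] (fun i => by fin_cases i; exact hu) hli
  haveI : Algebra.IsAlgebraic K₂
      (IntermediateField.adjoin K₂ (Set.range ![u] ∪ Set.range (Complex.exp ∘ ![u]))) := by
    refine isAlgebraic_adjoin fun w hw => ?_
    rcases hw with ⟨i, rfl⟩ | ⟨i, rfl⟩
    · obtain rfl : i = 0 := Subsingleton.elim _ _
      exact huK.isIntegral
    · obtain rfl : i = 0 := Subsingleton.elim _ _
      exact halg.isIntegral
  rw [trdeg_eq_zero] at h1
  exact absurd h1 (by norm_num)

end CoreRelCalibration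

/-- **Registered stub `stub_coreRel_calibration` of line `sector-split`** (signature verbatim):
residue 2 (`CoreRel`) alone implies the transcendence of `e^{π²}` (printed open, Waldschmidt 2000
§1.4) and of `e^e` (open) — its first instances `x = (π²)` and `x = (e)`.  So residue 2 is
open-problem strength independently of residue 1. [folklore] -/
theorem stub_coreRel_calibration :
    (∀ (n : ℕ) (x : Fin n → ℂ),
      (∀ i, x i ∈ (sInf {K : IntermediateField ℚ ℂ | (2 * ↑Real.pi * Complex.I : ℂ) ∈ K ∧
        (∀ w ∈ K, Complex.exp w ∈ K) ∧ ∀ w : ℂ, IsAlgebraic K w → w ∈ K} : IntermediateField ℚ ℂ)) →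
      LinearIndependent ℚ ((Submodule.span ℚ ({z : ℂ | IsAlgebraic ℚ z} ∪ {(Real.pi : ℂ) * Complex.I})).mkQ ∘ x) →
      (n : Cardinal) ≤ Algebra.trdeg
        ↥(IntermediateField.adjoin ℚ ({z : ℂ | IsAlgebraic ℚ z} ∪ {(Real.pi : ℂ) * Complex.I} ∪ Complex.exp '' {z : ℂ | IsAlgebraic ℚ z}))
        ↥(IntermediateField.adjoin ↥(IntermediateField.adjoin ℚ ({z : ℂ | IsAlgebraic ℚ z} ∪ {(Real.pi : ℂ) * Complex.I} ∪ Complex.exp '' {z : ℂ | IsAlgebraic ℚ z})) (Set.range x ∪ Set.range (Complex.exp ∘ x)))) →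
    Transcendental ℚ (Complex.exp ((Real.pi : ℂ) ^ 2)) ∧ Transcendental ℚ (Complex.exp (Complex.exp 1)) := by
  intro hC
  set K₂ : IntermediateField ℚ ℂ := IntermediateField.adjoin ℚ ({z : ℂ | IsAlgebraic ℚ z} ∪
    {(Real.pi : ℂ) * Complex.I} ∪ Complex.exp '' {z : ℂ | IsAlgebraic ℚ z}) with hK₂
  have hpiI : (Real.pi : ℂ) * I ∈ K₂ := subset_adjoin ℚ _ (.inl (.inr rfl))
  -- instance `x = (π²)`
  have hpi2_core : (Real.pi : ℂ) ^ 2 ∈ logFreeCore := pow_mem CalibrationR.pi_mem_logFreeCore 2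
  have hpi2_K : ((Real.pi : ℂ) ^ 2) ∈ K₂ := by
    have h : (Real.pi : ℂ) ^ 2 = -(((Real.pi : ℂ) * I) ^ 2) := by
      rw [mul_pow, Complex.I_sq]; ring
    rw [h]
    exact neg_mem (pow_mem hpiI 2)
  have hT1 := CoreRelCalibration.transcendental_exp_of_coreRel hC hpi2_core
    CoreRelCalibration.pi_sq_not_mem_span (isAlgebraic_algebraMap (⟨_, hpi2_K⟩ : K₂))
  -- instance `x = (e)`
  have he_core : cexp 1 ∈ logFreeCore := logFreeCore_mem_coreFamily.2.1 1 (one_mem _)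
  have he_K : cexp 1 ∈ K₂ := subset_adjoin ℚ _ (.inr ⟨1, isAlgebraic_one, rfl⟩)
  have hT2 := CoreRelCalibration.transcendental_exp_of_coreRel hC he_core
    CoreRelCalibration.exp_one_not_mem_span (isAlgebraic_algebraMap (⟨_, he_K⟩ : K₂))
  exact ⟨fun h => hT1 (h.tower_top (L := K₂)), fun h => hT2 (h.tower_top (L := K₂))⟩

end Summit.Schanuel.Schanuel.Theorems.RigidCore

end
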